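import Mathlib
import HarnessLib
import Summits.HubbardSuperconductivity.HubbardSuperconductivity.Theorems.KLProgrammeFreeBandJetProgram

/-!
# Route `KLProgramme` — ENGINE crux `KLRegimeEngineV17F2` (stmt-HubbardSuperconductivity-20437), row (C); c4a-1's `KlwjCertB` —
# KLWJ-INKERNEL part 3a′: THE TABLE `klwjTableB` AS RATIONALS
# (cell gate-hubbard-kl, seat hubbard-kl-k3c5-p1 g21; docket «KLWJ-INKERNEL-ROUTE» (p1b g19 memo 5340b98f1348eb46); 0 kit)

The thirteen derivative rows of `klwjTableB` (`…PerturbedFermiCurveWindowJetsDefs`; window `[-1.1, -0.1]`, c4a-1's `KlwjCertB`) as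
rationals, for the same checker/program/parameters as table A (`…FreeBandJetProgram`).  Data only; nothing asserted.
-/

namespace Summit.HubbardSuperconductivity.HubbardSuperconductivity.Theorems.FreeBandJets

set_option linter.dupNamespace false -- summit = problem name (single-conjunct summit), D-0017

/-- The thirteen derivative rows of `klwjTableB` (`R1 … R4`, `D1 … D4`, `G0 … G4`) as rationals. -/
def tabB : Tab := ⟨1549/1000, 2282/100, 2567/10, 8683, 4696/1000, 5942/100, 5781/10, 19070, 4538/1000, 1862/100, 4699/10, 9648, 422400⟩

end Summit.HubbardSuperconductivity.HubbardSuperconductivity.Theorems.FreeBandJets
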